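import Literature.Geometry.Lorentzian.SpacetimeMetricInCoordsCalculus
import HarnessLib

/-!
# Chart independence of `Cᵏ_loc` convergence of metric deviations
(topic `Geometry/Lorentzian`; infrastructure for pointed `Cᵏ_loc` convergence of spacetimes,
`SpacetimeLocalConvergence.lean`: the module docstring there records that convergence of the
components in the preferred charts "is equivalent to `Cᵏ_loc` convergence in any smooth atlas
(chain rule on compact sets; not proved here)" — this file proves the transfer)

For a spacetime `𝓤`, a family of spacetimes `𝓢 i` and maps `E i : 𝓤 → 𝓢 i` (comparison maps of a
convergence datum, or composites of such), the **chart deviation** at `x : 𝓤` is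
`chartDeviation (𝓢 i) (E i) x = (E i ∘ c_x⁻¹)^* g_{𝓢 i} − (c_x⁻¹)^* g_𝓤 : E4 → (E4 →L E4 →L ℝ)`,
`c_x = chartAt E4 x` (for a datum `D`, `D.coordDeviation n x` is `chartDeviation _ (D.embed n) x`).

Main results:

* `chartDeviation_eq_bilinPullback` — the **transformation law**: where both charts apply,
  `chartDeviation E x = (c_{x'} ∘ c_x⁻¹)^* (chartDeviation E x')` (`bilinPullback`), pointwise and
  as germs.
* `supCkENorm` bookkeeping: `supCkENorm_add_le` (subadditivity on functions smooth near the set),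
  `supCkENorm_congr` (germ invariance), `supCkENorm_biUnion_finset_le` (finite unions),
  and the metric **piece decomposition** `exists_finset_closedBall_pieces_of_isCompact` of a compact
  set subordinate to an open cover.
* `tendsto_supCkENorm_chartDeviation_of_reference` — **TRANSFER THEOREM**: if the `Cᵏ` sup norms
  of the chart deviations tend to `0` on a reference family of compact chart pieces whose open
  cores cover `𝓤`, and every compact set is eventually contained in an open set on which `E i` is
  `C^∞`, then they tend to `0` on EVERY compact subset of EVERY preferred chart target
  (Petersen 2006, Ch. 10, §3.2: "clearly independent of the covering"; Anderson 2004, Def. 1.1).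
  This is the reduction of the convergence clause of `LocalSubconvergence` to countably many
  reference pieces used by diagonal arguments.

## References
* [Petersen2006] P. Petersen, *Riemannian Geometry*, 2nd ed., GTM 171, Springer 2006, Ch. 10, §3.2.
* [Anderson2004] M. T. Anderson, Cheeger–Gromov theory and applications to general relativity,
  Birkhäuser 2004, Def. 1.1.
-/

noncomputable section

open TopologicalSpace Manifold Filter Topology Set Function Metric
open scoped ContDiff Topology ENNReal

universe u v w

namespace Literature.Geometry.Lorentzian

/-! ### `supCkENorm` bookkeeping -/

section SupNorm

variable {F G : Type*} [NormedAddCommGroup F] [NormedSpace ℝ F] [NormedAddCommGroup G]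
  [NormedSpace ℝ G]

/-- **Germ invariance**: functions with the same germ at every point of `S` have the same `Cᵏ`
sup norm over `S` (iterated derivatives are local). [folklore] -/
theorem supCkENorm_congr {S : Set F} {k : ℕ} {f g : F → G} (h : ∀ x ∈ S, f =ᶠ[𝓝 x] g) :
    supCkENorm S k f = supCkENorm S k g := by
  unfold supCkENorm
  refine iSup_congr fun m ↦ iSup_congr fun _ ↦ iSup_congr fun x ↦ iSup_congr fun hx ↦ ?_
  rw [((h x hx).iteratedFDeriv ℝ m).eq_of_nhds]

/-- **Subadditivity** of the `Cᵏ` sup norm on functions which are `Cᵏ` at every point of the set.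
[folklore] -/
theorem supCkENorm_add_le {S : Set F} {k : ℕ} {f g : F → G} (hf : ∀ x ∈ S, ContDiffAt ℝ k f x)
    (hg : ∀ x ∈ S, ContDiffAt ℝ k g x) :
    supCkENorm S k (f + g) ≤ supCkENorm S k f + supCkENorm S k g := by
  refine supCkENorm_le_of_forall_le fun m hm x hx ↦ ?_
  have hm' : (m : WithTop ℕ∞) ≤ k := by exact_mod_cast hm
  rw [iteratedFDeriv_add_apply ((hf x hx).of_le hm') ((hg x hx).of_le hm')]
  exact (enorm_add_le (iteratedFDeriv ℝ m f x) (iteratedFDeriv ℝ m g x)).trans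
    (add_le_add (enorm_iteratedFDeriv_le_supCkENorm hm hx f)
      (enorm_iteratedFDeriv_le_supCkENorm hm hx g))

/-- The `Cᵏ` sup norm over a finite union is at most the sum of the sup norms over the pieces.
[folklore] -/
theorem supCkENorm_biUnion_finset_le {ι : Type*} (T : Finset ι) (P : ι → Set F) (k : ℕ)
    (f : F → G) : supCkENorm (⋃ i ∈ T, P i) k f ≤ ∑ i ∈ T, supCkENorm (P i) k f := by
  refine supCkENorm_le_of_forall_le fun m hm x hx ↦ ?_
  obtain ⟨i, hi, hxi⟩ := mem_iUnion₂.1 hx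
  exact (enorm_iteratedFDeriv_le_supCkENorm hm hxi f).trans
    (Finset.single_le_sum (f := fun i ↦ supCkENorm (P i) k f) (fun _ _ ↦ zero_le) hi)

end SupNorm

/-! ### Piece decomposition of a compact set subordinate to an open cover -/

section Pieces

variable {X : Type*} [MetricSpace X]

/-- **Piece decomposition.** A compact set `K` covered by open sets `O a` is a finite union of
the compact pieces `K ∩ closedBall y (ε y)`, `y` in a finite set, each contained in a single
member `O a` of the cover (Lebesgue-number argument, pointwise form). [folklore] -/
theorem exists_finset_closedBall_pieces_of_isCompact {K : Set X} (hK : IsCompact K) {A : Type*}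
    (O : A → Set X) (hO : ∀ a, IsOpen (O a)) (hcov : K ⊆ ⋃ a, O a) :
    ∃ (S : Finset X) (ε : X → ℝ),
      (∀ y ∈ S, ∃ a, K ∩ closedBall y (ε y) ⊆ O a) ∧ K ⊆ ⋃ y ∈ S, K ∩ closedBall y (ε y) := by
  classical
  have hchoice : ∀ y ∈ K, ∃ (ε : ℝ), 0 < ε ∧ ∃ a, closedBall y ε ⊆ O a := by
    intro y hy
    obtain ⟨a, ha⟩ := mem_iUnion.1 (hcov hy)
    obtain ⟨ε, hε, hεO⟩ := Metric.nhds_basis_closedBall.mem_iff.1 ((hO a).mem_nhds ha)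
    exact ⟨ε, hε, a, hεO⟩
  choose! ε hε hεO using hchoice
  obtain ⟨S, hS⟩ := hK.elim_nhds_subcover' (fun y _ ↦ ball y (ε y))
    fun y hy ↦ ball_mem_nhds y (hε y hy)
  refine ⟨S.image Subtype.val, ε, fun y hy ↦ ?_, fun p hp ↦ ?_⟩
  · obtain ⟨y', hy', rfl⟩ := Finset.mem_image.1 hy
    obtain ⟨a, ha⟩ := hεO _ y'.2
    exact ⟨a, inter_subset_right.trans ha⟩
  · obtain ⟨y', hy', hpy⟩ := mem_iUnion₂.1 (hS hp)
    refine mem_iUnion₂.2 ⟨(y' : X), Finset.mem_image_of_mem _ hy', hp, ?_⟩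
    exact ball_subset_closedBall hpy

end Pieces

namespace Spacetime

/-! ### The chart deviation of a map and its transformation law -/

section ChartDeviation

variable {𝓤 : Spacetime.{w} 4}

/-- The **chart deviation** of a map `E : 𝓤 → 𝓢` in the preferred chart of `𝓤` at `x`: the
components of `E^* g_𝓢` minus the components of `g_𝓤`, read in `chartAt E4 x`
(`LocalSubconvergence.coordDeviation` of `SpacetimeLocalConvergence.lean` for the comparison maps of
a convergence datum; Anderson 2004, Def. 1.1). [cite: Anderson2004, Def. 1.1] -/
def chartDeviation (𝓢 : Spacetime.{u} 4) (E : 𝓤.carrier → 𝓢.carrier) (x : 𝓤.carrier) :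
    E4 → E4 →L[ℝ] E4 →L[ℝ] ℝ :=
  𝓢.metricInCoords (E ∘ (chartAt E4 x).symm) - 𝓤.metricInCoords (chartAt E4 x).symm

/-- Unfolding `chartDeviation` at a point. [folklore] -/
theorem chartDeviation_apply (𝓢 : Spacetime.{u} 4) (E : 𝓤.carrier → 𝓢.carrier) (x : 𝓤.carrier)
    (y : E4) : chartDeviation 𝓢 E x y =
      𝓢.metricInCoords (E ∘ (chartAt E4 x).symm) y - 𝓤.metricInCoords (chartAt E4 x).symm y :=
  rfl

/-- The deviation of a convergence datum is the chart deviation of its comparison map. [folklore] -/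
theorem _root_.Literature.Geometry.Lorentzian.Spacetime.LocalSubconvergence.coordDeviation_eq_chartDeviation
    {𝓢ₙ : ℕ → Spacetime.{u} 4} {pₙ : ∀ n, (𝓢ₙ n).carrier} {p : 𝓤.carrier} {k : ℕ}
    (D : LocalSubconvergence 𝓢ₙ pₙ 𝓤 p k) (n : ℕ) (x : 𝓤.carrier) :
    D.coordDeviation n x = chartDeviation (𝓢ₙ (D.sub n)) (D.embed n) x := rfl

/-- **Smoothness of the chart deviation**: if `E` is `C^∞` on an open set `W`, its chart deviation
at `x` is `C^∞` on `c_x.target ∩ c_x⁻¹(W)`. [folklore] -/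
theorem contDiffOn_chartDeviation (𝓢 : Spacetime.{u} 4) {E : 𝓤.carrier → 𝓢.carrier}
    {W : Set 𝓤.carrier} (hW : IsOpen W) (hE : ContMDiffOn (𝓡 4) (𝓡 4) ∞ E W) (x : 𝓤.carrier) :
    ContDiffOn ℝ ∞ (chartDeviation 𝓢 E x)
      ((chartAt E4 x).target ∩ (chartAt E4 x).symm ⁻¹' W) :=
  (𝓤.contDiffOn_metricInCoords_comp_chartAt_symm x hW hE).sub
    ((𝓤.contDiffOn_metricInCoords_chartAt_symm x).mono inter_subset_left)

/-- **Transformation law of the chart deviation** (pointwise): at a point `y` of the chart target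
at `x` whose image `c_x⁻¹ y` lies in the chart source at `x'` and at which `E` is differentiable,
`chartDeviation E x y = bilinPullback (c_{x'} ∘ c_x⁻¹) (chartDeviation E x') y` — both terms are
components of covariant `2`-tensors and transform alike (Petersen 2006, Ch. 10, §3.2).
[cite: Petersen2006, Ch. 10 §3.2] -/
theorem chartDeviation_eq_bilinPullback (𝓢 : Spacetime.{u} 4) {E : 𝓤.carrier → 𝓢.carrier}
    {x x' : 𝓤.carrier} {y : E4} (hy : y ∈ (chartAt E4 x).target)
    (hy' : (chartAt E4 x).symm y ∈ (chartAt E4 x').source)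
    (hE : MDifferentiableAt (𝓡 4) (𝓡 4) E ((chartAt E4 x).symm y)) :
    chartDeviation 𝓢 E x y =
      bilinPullback (chartTransition (id : 𝓤.carrier → 𝓤.carrier) x x')
        (chartDeviation 𝓢 E x') y := by
  have h := metricInCoords_comp_comp_sub_eq (G := E) (F := (id : 𝓤.carrier → 𝓤.carrier))
    (x := x) (x' := x') hy mdifferentiableAt_id hy' hE
  simp only [Function.id_comp, Function.comp_id] at h
  -- evaluate on vectors (the scalar identity is immediate)
  ext v w
  have h' := congrArg (fun T : E4 →L[ℝ] E4 →L[ℝ] ℝ ↦ T v w) h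
  simp only [add_apply, sub_apply, bilinPullback_apply, Pi.sub_apply, sub_self, add_zero] at h'
  simp only [chartDeviation, Pi.sub_apply, sub_apply, bilinPullback_apply]
  exact h'

/-- Germ form of the transformation law: if moreover `E` is differentiable on an open set
`W ∋ c_x⁻¹ y`, the identity holds near `y`. [cite: Petersen2006, Ch. 10 §3.2] -/
theorem chartDeviation_eventuallyEq_bilinPullback (𝓢 : Spacetime.{u} 4)
    {E : 𝓤.carrier → 𝓢.carrier} {x x' : 𝓤.carrier} {y : E4} (hy : y ∈ (chartAt E4 x).target)
    (hy' : (chartAt E4 x).symm y ∈ (chartAt E4 x').source) {W : Set 𝓤.carrier} (hW : IsOpen W)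
    (hyW : (chartAt E4 x).symm y ∈ W) (hE : ∀ p ∈ W, MDifferentiableAt (𝓡 4) (𝓡 4) E p) :
    chartDeviation 𝓢 E x =ᶠ[𝓝 y]
      bilinPullback (chartTransition (id : 𝓤.carrier → 𝓤.carrier) x x')
        (chartDeviation 𝓢 E x') := by
  have hc : ContinuousAt (chartAt E4 x).symm y := (chartAt E4 x).continuousAt_symm hy
  have h1 : ∀ᶠ y' in 𝓝 y, y' ∈ (chartAt E4 x).target := (chartAt E4 x).open_target.mem_nhds hy
  have h2 : ∀ᶠ y' in 𝓝 y, (chartAt E4 x).symm y' ∈ (chartAt E4 x').source :=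
    hc.preimage_mem_nhds ((chartAt E4 x').open_source.mem_nhds hy')
  have h3 : ∀ᶠ y' in 𝓝 y, (chartAt E4 x).symm y' ∈ W := hc.preimage_mem_nhds (hW.mem_nhds hyW)
  filter_upwards [h1, h2, h3] with y' h1 h2 h3
  exact chartDeviation_eq_bilinPullback 𝓢 h1 h2 (hE _ h3)

end ChartDeviation

/-! ### The transfer theorem -/

section Transfer

variable {𝓤 : Spacetime.{w} 4}

/-- **Chart independence of `Cᵏ_loc` convergence of deviations (transfer to arbitrary charts).**
Let `E i : 𝓤 → 𝓢 i` be maps such that every compact subset of `𝓤` is, eventually along `l`,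
contained in an open set on which `E i` is `C^∞`. Suppose a reference family of chart pieces is
given — points `z j`, open sets `V j ⊆ K' j ⊆ (chartAt E4 (z j)).target` with `K' j` compact, whose
pullbacks `c_{z j}⁻¹(V j)` cover `𝓤` — on which the `Cᵏ` sup norms of the chart deviations tend to
`0`. Then for EVERY point `x` and EVERY compact `K ⊆ (chartAt E4 x).target` the `Cᵏ` sup norm of
the chart deviation at `x` over `K` tends to `0`: cut `K` into finitely many compact pieces each
mapped by `c_{z j} ∘ c_x⁻¹` into some `V j`, transport the deviation by the transformation law
(`chartDeviation_eq_bilinPullback`) and use that pulling back along a fixed smooth map is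
continuous for `Cᵏ_loc` convergence to zero (`tendsto_supCkENorm_bilinPullback`). Petersen 2006,
Ch. 10, §3.2 ("clearly independent of the covering"); Anderson 2004, Def. 1.1.
[cite: Petersen2006, Ch. 10 §3.2] -/
theorem tendsto_supCkENorm_chartDeviation_of_reference {ι : Type*} {l : Filter ι} {k : ℕ}
    {𝓢 : ι → Spacetime.{u} 4} {E : ∀ i, 𝓤.carrier → (𝓢 i).carrier}
    (hE : ∀ C : Set 𝓤.carrier, IsCompact C → ∀ᶠ i in l,
      ∃ W : Set 𝓤.carrier, IsOpen W ∧ C ⊆ W ∧ ContMDiffOn (𝓡 4) (𝓡 4) ∞ (E i) W)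
    {J : Type*} (z : J → 𝓤.carrier) (V K' : J → Set E4) (hV : ∀ j, IsOpen (V j))
    (hVK : ∀ j, V j ⊆ K' j) (hK' : ∀ j, IsCompact (K' j))
    (hK't : ∀ j, K' j ⊆ (chartAt E4 (z j)).target)
    (hcov : ∀ p : 𝓤.carrier, ∃ j, p ∈ (chartAt E4 (z j)).source ∧ chartAt E4 (z j) p ∈ V j)
    (href : ∀ j, Tendsto (fun i ↦ supCkENorm (K' j) k (chartDeviation (𝓢 i) (E i) (z j))) l (𝓝 0))
    (x : 𝓤.carrier) {K : Set E4} (hK : IsCompact K) (hKt : K ⊆ (chartAt E4 x).target) :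
    Tendsto (fun i ↦ supCkENorm K k (chartDeviation (𝓢 i) (E i) x)) l (𝓝 0) := by
  classical
  set c := chartAt E4 x with hc
  -- the open sets `O j ⊆ E4` of chart points transported into the core `V j`
  set O : J → Set E4 := fun j ↦
    c.target ∩ c.symm ⁻¹' ((chartAt E4 (z j)).source ∩ chartAt E4 (z j) ⁻¹' V j) with hO
  have hOo : ∀ j, IsOpen (O j) := fun j ↦
    c.continuousOn_symm.isOpen_inter_preimage c.open_target
      ((chartAt E4 (z j)).continuousOn.isOpen_inter_preimage (chartAt E4 (z j)).open_source (hV j))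
  have hKO : K ⊆ ⋃ j, O j := fun y hy ↦ by
    obtain ⟨j, hj1, hj2⟩ := hcov (c.symm y)
    exact mem_iUnion.2 ⟨j, hKt hy, hj1, hj2⟩
  obtain ⟨S, ε, hSO, hKS⟩ := exists_finset_closedBall_pieces_of_isCompact hK O hOo hKO
  -- the pieces
  set P : E4 → Set E4 := fun y ↦ K ∩ closedBall y (ε y) with hP
  have hPc : ∀ y, IsCompact (P y) := fun y ↦ hK.inter_right isClosed_closedBall
  have hPK : ∀ y, P y ⊆ K := fun y ↦ inter_subset_left
  -- estimate on each piece
  have hpiece : ∀ y ∈ S,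
      Tendsto (fun i ↦ supCkENorm (P y) k (chartDeviation (𝓢 i) (E i) x)) l (𝓝 0) := by
    intro y hy
    obtain ⟨j, hPO⟩ := hSO y hy
    set c' := chartAt E4 (z j) with hc'
    -- the transition map `θ = c' ∘ c⁻¹` is smooth on the open set `s ⊇ P y`
    set θ : E4 → E4 := chartTransition (id : 𝓤.carrier → 𝓤.carrier) x (z j) with hθ
    set s : Set E4 := transitionDomain (id : 𝓤.carrier → 𝓤.carrier) univ x (z j) with hs
    have hso : IsOpen s := isOpen_transitionDomain isOpen_univ continuousOn_id x (z j)
    have hθs : ContDiffOn ℝ ∞ θ s := contDiffOn_chartTransition contMDiffOn_id x (z j)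
    have hPs : P y ⊆ s := fun y' hy' ↦ by
      have h := hPO hy'
      exact mem_transitionDomain.2 ⟨h.1, mem_univ _, h.2.1⟩
    have hθP : MapsTo θ (P y) (K' j) := fun y' hy' ↦ hVK j (hPO hy').2.2
    -- smoothness of the reference deviations near `K' j`, eventually
    have hB : ∀ᶠ i in l, ∃ t : Set E4, IsOpen t ∧ K' j ⊆ t ∧
        ContDiffOn ℝ k (chartDeviation (𝓢 i) (E i) (z j)) t := by
      have hC : IsCompact (c'.symm '' K' j) :=
        (hK' j).image_of_continuousOn (c'.continuousOn_symm.mono (hK't j))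
      filter_upwards [hE _ hC] with i ⟨W, hW, hCW, hEW⟩
      refine ⟨c'.target ∩ c'.symm ⁻¹' W, c'.continuousOn_symm.isOpen_inter_preimage
        c'.open_target hW, fun y' hy' ↦ ⟨hK't j hy', hCW (mem_image_of_mem _ hy')⟩, ?_⟩
      exact ((contDiffOn_chartDeviation (𝓢 i) hW hEW (z j)).of_le (by exact_mod_cast le_top))
    have hlim := tendsto_supCkENorm_bilinPullback hso
      ((hθs.of_le (by exact_mod_cast le_top)) : ContDiffOn ℝ (k + 1) θ s) (hPc y) hPs hθP hB
      (href j)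
    -- the germ identity on the piece, eventually
    have hgerm : ∀ᶠ i in l, ∀ y' ∈ P y, chartDeviation (𝓢 i) (E i) x =ᶠ[𝓝 y']
        bilinPullback θ (chartDeviation (𝓢 i) (E i) (z j)) := by
      have hC : IsCompact (c.symm '' K) := hK.image_of_continuousOn (c.continuousOn_symm.mono hKt)
      filter_upwards [hE _ hC] with i ⟨W, hW, hCW, hEW⟩ y' hy'
      have h := hPO hy'
      exact chartDeviation_eventuallyEq_bilinPullback (𝓢 i) h.1 h.2.1 hW
        (hCW (mem_image_of_mem _ (hPK y hy'))) fun p hp ↦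
          ((hEW p hp).mdifferentiableWithinAt (by simp)).mdifferentiableAt (hW.mem_nhds hp)
    refine (tendsto_congr' ?_).2 hlim
    filter_upwards [hgerm] with i hi
    exact supCkENorm_congr hi
  -- assemble the pieces
  have hsum : Tendsto (fun i ↦ ∑ y ∈ S, supCkENorm (P y) k (chartDeviation (𝓢 i) (E i) x)) l
      (𝓝 0) := by
    have h := tendsto_finsetSum S fun y hy ↦ hpiece y hy
    simpa using h
  refine tendsto_of_tendsto_of_tendsto_of_le_of_le tendsto_const_nhds hsum (fun _ ↦ zero_le)
    fun i ↦ ?_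
  exact (supCkENorm_mono hKS k _).trans (supCkENorm_biUnion_finset_le S P k _)

/-- **Corollary (convergence data).** For a datum `D : LocalSubconvergence 𝓢ₙ pₙ 𝓤 p k` the
convergence clause, a priori one statement per point and compact chart piece, follows from its
restriction to any reference family of chart pieces whose open cores cover the limit. [cite: Petersen2006, Ch. 10 §3.2] -/
theorem LocalSubconvergence.tendsto_supCkENorm_of_reference {𝓢ₙ : ℕ → Spacetime.{u} 4}
    {pₙ : ∀ n, (𝓢ₙ n).carrier} {p : 𝓤.carrier} {k : ℕ} (D : LocalSubconvergence 𝓢ₙ pₙ 𝓤 p k)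
    {J : Type*} (z : J → 𝓤.carrier) (V K' : J → Set E4) (hV : ∀ j, IsOpen (V j))
    (hVK : ∀ j, V j ⊆ K' j) (hK' : ∀ j, IsCompact (K' j))
    (hK't : ∀ j, K' j ⊆ (chartAt E4 (z j)).target)
    (hcov : ∀ q : 𝓤.carrier, ∃ j, q ∈ (chartAt E4 (z j)).source ∧ chartAt E4 (z j) q ∈ V j)
    (href : ∀ j, Tendsto (fun n ↦ supCkENorm (K' j) k (D.coordDeviation n (z j))) atTop (𝓝 0))
    (x : 𝓤.carrier) {K : Set E4} (hK : IsCompact K) (hKt : K ⊆ (chartAt E4 x).target) :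
    Tendsto (fun n ↦ supCkENorm K k (D.coordDeviation n x)) atTop (𝓝 0) := by
  have hE : ∀ C : Set 𝓤.carrier, IsCompact C → ∀ᶠ n in atTop, ∃ W : Set 𝓤.carrier,
      IsOpen W ∧ C ⊆ W ∧ ContMDiffOn (𝓡 4) (𝓡 4) ∞ (D.embed n) W := by
    intro C hC
    filter_upwards [D.eventually_subset_U hC] with n hn
    exact ⟨D.U n, (D.U n).isOpen, hn, D.contMDiffOn_embed n⟩
  exact tendsto_supCkENorm_chartDeviation_of_reference (𝓢 := fun n ↦ 𝓢ₙ (D.sub n))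
    (E := fun n ↦ D.embed n) hE z V K' hV hVK hK' hK't hcov href x hK hKt

end Transfer

end Spacetime

/-! ### Swapping the terms of a difference under `supCkENorm` -/

section SupNormSwap

variable {F G : Type*} [NormedAddCommGroup F] [NormedSpace ℝ F] [NormedAddCommGroup G]
  [NormedSpace ℝ G]

/-- **Swap symmetry**: the `Cᵏ` sup norm of `f − g` over `S` equals that of `g − f`
(`Dᵐ (−u) = −Dᵐ u` unconditionally for Mathlib's `iteratedFDeriv`, and `‖−v‖ₑ = ‖v‖ₑ`). Promoted
from three private copies in `Summits/…/Theorems/ClusterCompletenessOmegaLimitMultiKerr{OmegaLimitSetCompact,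
OmegaLimitSetConnected,UniformRecurrence}.lean`. [folklore] -/
theorem supCkENorm_sub_comm (S : Set F) (k : ℕ) (f g : F → G) :
    supCkENorm S k (fun x ↦ f x - g x) = supCkENorm S k (fun x ↦ g x - f x) := by
  have hfg : (fun x ↦ f x - g x) = -fun x ↦ g x - f x := by
    funext x
    simp only [Pi.neg_apply, neg_sub]
  simp only [supCkENorm, hfg, iteratedFDeriv_neg_apply, enorm_neg]

end SupNormSwap

end Literature.Geometry.Lorentzian
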